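import Summits.ResolutionOfSingularities.ResolutionOfSingularities.Theorems.PurelyInseparableDim4PureLeafUnitOddReservoirSteps
import HarnessLib
import HarnessLib.Audit.Tags

/-!
# Purely inseparable fourfolds — THE RESERVOIR CANNOT BE CASHED: `S²(x₀ + x₀²x₁)` and `S²(x₀ + x₁ + x₀²x₁)` are plain-game A-WINS over `𝔽₂` for every even dress `S²` ‖ K
# (cell res-dim4-pi; brick (δ) «unit leaves x^a(1+x_j)», UNIFORM family «a₀ = 1, one odd partner, even rest») [OURS · counted 0 · a theorem about OUR coordinate-centre frame v4, not about resolution]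

Width seat `res-dim4-p-10` (g5).  THIS FILE (the theorem): **`stateWins_QR`** — for every even dress
`S² = x₂^{g₂}(1+x₂)^{e₂}x₃^{g₃}(1+x₃)^{e₃}` and EVERY booking, the `Q`-state `S²(x₀ + x₀²x₁)` and the `R`-state `S²(x₀ + x₁ + x₀²x₁)`
are A-WINS of the plain game over `𝔽₂` (`stateWins_Q`, `stateWins_R`).  A's strategy: grind `{x₂}` / `{x₃}` while an `x`-exponent of
the dress is left (the transitions of `…UnitOddReservoirSteps` keep the class, the dress weight `g₂+g₃+e₂+e₃` drops by `2`); when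
`g₂ = g₃ = 0` the state contains the monomial `x₀` (`coeff_X0_Q`, `coeff_X0_R`), so NO coordinate centre is permissible and A has
won (`not_isPermissibleCentre_of_coeff_X0`).  Strong induction on the weight.  This is the «reservoir» half of the uniform
theorem for the unit leaves `x₀x₁^{m}x₂^{2b}x₃^{2c}(1+x₀)` (`m` odd), completed in `…PureLeafUnitOddPair`.

Riders: `𝔽₂`-rational replies (the game over `ZMod 2`); the PLAIN coordinate game of OUR frame v4 (`StateWins 2`), not MODE 1h
and not CJS's algorithm; nothing here proves F4-C(2,2), `Terminates1h 2 2` or resolution of singularities in dimension ≥ 4 /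
characteristic `p`; counted 0; AI kernel work, weaker than expert review. bears_on: LADDER-RESOLUTION:D157-DOOR2 (res-dim4-pi ·
brick (δ) · unit-leaf row, uniform theorem). Supports stmt-ResolutionOfSingularities-16155 (helper).
-/

set_option linter.dupNamespace false

open MvPolynomial Finset

open scoped BigOperators

noncomputable section

namespace Summit.ResolutionOfSingularities.ResolutionOfSingularities.Theorems.PIDim4

namespace PureLeafNF

open Literature.AlgebraicGeometry.Resolution
open Literature.AlgebraicGeometry.Resolution.Hauser2010
open CentreBlowup PthPowerFactor

/-! ## 5. No permissible centre once the dress has no `x`-part; the induction -/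

/-- The monomial `x₀` occurs in a `Q`-state with `g₂ = g₃ = 0`. [folklore] -/
theorem coeff_X0_Q (e2 e3 : ℕ) : coeff (Finsupp.single 0 1) ((∏ l, X l ^ (![1, 0, 0, 0] : Fin 4 → ℕ) l * (1 + X l) ^ (![0, 0, e2, e3] : Fin 4 → ℕ) l : MvPolynomial (Fin 4) (ZMod 2)) + (∏ l, X l ^ (![2, 1, 0, 0] : Fin 4 → ℕ) l * (1 + X l) ^ (![0, 0, e2, e3] : Fin 4 → ℕ) l : MvPolynomial (Fin 4) (ZMod 2))) = 1 := by
  have hs : (Finsupp.single (0 : Fin 4) 1 : Fin 4 →₀ ℕ) = Finsupp.equivFunOnFinite.symm (![1, 0, 0, 0] : Fin 4 → ℕ) := by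
    ext l; fin_cases l <;> simp
  rw [coeff_add, hs, coeff_self_prod]
  rw [MvPolynomial.notMem_support_iff.mp, add_zero]
  intro hmem
  have hle := le_of_mem_support_prod (![2, 1, 0, 0] : Fin 4 → ℕ) (![0, 0, e2, e3] : Fin 4 → ℕ) hmem
  have h1 := hle 1
  simp at h1

/-- The monomial `x₀` occurs in an `R`-state with `g₂ = g₃ = 0`. [folklore] -/
theorem coeff_X0_R (e2 e3 : ℕ) : coeff (Finsupp.single 0 1) ((∏ l, X l ^ (![1, 0, 0, 0] : Fin 4 → ℕ) l * (1 + X l) ^ (![0, 0, e2, e3] : Fin 4 → ℕ) l : MvPolynomial (Fin 4) (ZMod 2)) + (∏ l, X l ^ (![0, 1, 0, 0] : Fin 4 → ℕ) l * (1 + X l) ^ (![0, 0, e2, e3] : Fin 4 → ℕ) l : MvPolynomial (Fin 4) (ZMod 2)) + (∏ l, X l ^ (![2, 1, 0, 0] : Fin 4 → ℕ) l * (1 + X l) ^ (![0, 0, e2, e3] : Fin 4 → ℕ) l : MvPolynomial (Fin 4) (ZMod 2))) = 1 := by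
  have hs : (Finsupp.single (0 : Fin 4) 1 : Fin 4 →₀ ℕ) = Finsupp.equivFunOnFinite.symm (![1, 0, 0, 0] : Fin 4 → ℕ) := by
    ext l; fin_cases l <;> simp
  rw [coeff_add, coeff_add, hs, coeff_self_prod]
  rw [MvPolynomial.notMem_support_iff.mp, add_zero, MvPolynomial.notMem_support_iff.mp, add_zero]
  · intro hmem
    have hle := le_of_mem_support_prod (![2, 1, 0, 0] : Fin 4 → ℕ) (![0, 0, e2, e3] : Fin 4 → ℕ) hmem
    have h1 := hle 1
    simp at h1
  · intro hmem
    have hle := le_of_mem_support_prod (![0, 1, 0, 0] : Fin 4 → ℕ) (![0, 0, e2, e3] : Fin 4 → ℕ) hmem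
    have h1 := hle 1
    simp at h1

/-- A polynomial containing the monomial `x₀` has NO permissible coordinate centre (its order is `1`). [folklore] -/
theorem not_isPermissibleCentre_of_coeff_X0 (F : MvPolynomial (Fin 4) (ZMod 2)) (hF : coeff (Finsupp.single 0 1) F = 1)
    (T : Finset (Fin 4)) : ¬ IsPermissibleCentre 2 T F := by
  rintro ⟨-, h2⟩
  have hle := ordAlong_le_of_coeff_ne_zero (S := T) (F := F) (d := Finsupp.single 0 1) (by rw [hF]; exact one_ne_zero)
  have h := le_trans h2 hle
  rw [degIn_single] at h
  have h' : (2 : ℕ) ≤ (if (0 : Fin 4) ∈ T then 1 else 0) := by exact_mod_cast h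
  split_ifs at h' <;> omega

/-- The singleton centre `{x_i}` is permissible at a sum of two products both divisible by `x_i²`. [folklore] -/
theorem two_le_ordAlong_add (i : Fin 4) (a a' e e' : Fin 4 → ℕ) (ha : 2 ≤ a i) (ha' : 2 ≤ a' i) :
    (2 : ℕ∞) ≤ ordAlong {i} ((∏ l, X l ^ a l * (1 + X l) ^ e l : MvPolynomial (Fin 4) (ZMod 2)) +
      ∏ l, X l ^ a' l * (1 + X l) ^ e' l) := by
  refine le_trans (le_min ?_ ?_) (min_ordAlong_le_ordAlong_add _ _ _)
  · rw [ordAlong_prod, degIn_singleton]; exact_mod_cast ha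
  · rw [ordAlong_prod, degIn_singleton]; exact_mod_cast ha'

/-- … and at a sum of three such products. [folklore] -/
theorem two_le_ordAlong_add_add (i : Fin 4) (a a' a'' e e' e'' : Fin 4 → ℕ) (ha : 2 ≤ a i) (ha' : 2 ≤ a' i)
    (ha'' : 2 ≤ a'' i) :
    (2 : ℕ∞) ≤ ordAlong {i} ((∏ l, X l ^ a l * (1 + X l) ^ e l : MvPolynomial (Fin 4) (ZMod 2)) +
      (∏ l, X l ^ a' l * (1 + X l) ^ e' l) + ∏ l, X l ^ a'' l * (1 + X l) ^ e'' l) := by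
  refine le_trans (le_min (two_le_ordAlong_add i a a' e e' ha ha') ?_) (min_ordAlong_le_ordAlong_add _ _ _)
  rw [ordAlong_prod, degIn_singleton]; exact_mod_cast ha''

/-- **THE RESERVOIR CANNOT BE CASHED.**  For every even dress `S² = x₂^{g₂}(1+x₂)^{e₂}x₃^{g₃}(1+x₃)^{e₃}` and every booking,
the `Q`-state `S²(x₀ + x₀²x₁)` and the `R`-state `S²(x₀ + x₁ + x₀²x₁)` are A-WINS of the plain game over `𝔽₂`: A grinds the dress
(`{x₂}` / `{x₃}` while an `x`-exponent is left); B's translations only permute `Q ↔ R` and swap dress factors; when the `x`-part of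
the dress is gone the state has order `1` — no permissible centre, A has won.  Induction on the dress weight. [OURS · counted 0]
[folklore] -/
theorem stateWins_QR : ∀ n : ℕ, ∀ g2 g3 e2 e3 : ℕ, g2 % 2 = 0 → g3 % 2 = 0 → e2 % 2 = 0 → e3 % 2 = 0 →
    g2 + g3 + e2 + e3 ≤ n → ∀ (r : Fin 4 →₀ ℕ) (exc : Finset (Fin 4)),
      StateWins 2 (⟨((∏ l, X l ^ (![1, 0, g2, g3] : Fin 4 → ℕ) l * (1 + X l) ^ (![0, 0, e2, e3] : Fin 4 → ℕ) l : MvPolynomial (Fin 4) (ZMod 2)) + (∏ l, X l ^ (![2, 1, g2, g3] : Fin 4 → ℕ) l * (1 + X l) ^ (![0, 0, e2, e3] : Fin 4 → ℕ) l : MvPolynomial (Fin 4) (ZMod 2))), r, exc⟩ : State (ZMod 2)) ∧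
      StateWins 2 (⟨((∏ l, X l ^ (![1, 0, g2, g3] : Fin 4 → ℕ) l * (1 + X l) ^ (![0, 0, e2, e3] : Fin 4 → ℕ) l : MvPolynomial (Fin 4) (ZMod 2)) + (∏ l, X l ^ (![0, 1, g2, g3] : Fin 4 → ℕ) l * (1 + X l) ^ (![0, 0, e2, e3] : Fin 4 → ℕ) l : MvPolynomial (Fin 4) (ZMod 2)) + (∏ l, X l ^ (![2, 1, g2, g3] : Fin 4 → ℕ) l * (1 + X l) ^ (![0, 0, e2, e3] : Fin 4 → ℕ) l : MvPolynomial (Fin 4) (ZMod 2))), r, exc⟩ : State (ZMod 2)) := by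
  intro n
  induction n using Nat.strong_induction_on with
  | _ n IH =>
  intro g2 g3 e2 e3 hg2 hg3 he2 he3 hle r exc
  have hstate : ∀ t : State (ZMod 2), t = ⟨t.F, t.r, t.exc⟩ := fun t => rfl
  by_cases hzero : g2 = 0 ∧ g3 = 0
  · obtain ⟨rfl, rfl⟩ := hzero
    exact ⟨Game.Wins.terminal fun T hT => not_isPermissibleCentre_of_coeff_X0 _ (coeff_X0_Q e2 e3) T hT,
      Game.Wins.terminal fun T hT => not_isPermissibleCentre_of_coeff_X0 _ (coeff_X0_R e2 e3) T hT⟩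
  by_cases h2 : g2 = 0
  · -- grind x₃
    have hg3i : 2 ≤ g3 := by omega
    constructor
    · unfold StateWins
      refine Game.Wins.move (m := ({3} : Finset (Fin 4))) ⟨Finset.singleton_nonempty 3, ?_⟩ ?_
      · exact two_le_ordAlong_add 3 _ _ _ _ (by simpa using hg3i) (by simpa using hg3i)
      rintro s' ⟨j', b, hj', hbj, -, -, rfl⟩
      rw [Finset.mem_singleton] at hj'
      subst hj'
      rw [hstate (step 2 _ _ b _)]
      rcases step_F_grind3_Q g2 g3 e2 e3 hg2 hg3 he2 he3 hg3i b hbj r exc with ⟨hF, -⟩ | ⟨hF, -⟩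
      · rw [hF]
        exact (IH (g2 + g3 + e2 + e3 - 2) (by omega) _ _ _ _ (by split_ifs <;> assumption) (by omega)
          (by split_ifs <;> assumption) he3 (by split_ifs <;> omega) _ _).1
      · rw [hF]
        exact (IH (g2 + g3 + e2 + e3 - 2) (by omega) _ _ _ _ (by split_ifs <;> assumption) (by omega)
          (by split_ifs <;> assumption) he3 (by split_ifs <;> omega) _ _).2
    · unfold StateWins
      refine Game.Wins.move (m := ({3} : Finset (Fin 4))) ⟨Finset.singleton_nonempty 3, ?_⟩ ?_
      · exact two_le_ordAlong_add_add 3 _ _ _ _ _ _ (by simpa using hg3i) (by simpa using hg3i) (by simpa using hg3i)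
      rintro s' ⟨j', b, hj', hbj, -, -, rfl⟩
      rw [Finset.mem_singleton] at hj'
      subst hj'
      rw [hstate (step 2 _ _ b _)]
      rcases step_F_grind3_R g2 g3 e2 e3 hg2 hg3 he2 he3 hg3i b hbj r exc with ⟨hF, -⟩ | ⟨hF, -⟩
      · rw [hF]
        exact (IH (g2 + g3 + e2 + e3 - 2) (by omega) _ _ _ _ (by split_ifs <;> assumption) (by omega)
          (by split_ifs <;> assumption) he3 (by split_ifs <;> omega) _ _).2
      · rw [hF]
        exact (IH (g2 + g3 + e2 + e3 - 2) (by omega) _ _ _ _ (by split_ifs <;> assumption) (by omega)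
          (by split_ifs <;> assumption) he3 (by split_ifs <;> omega) _ _).1
  · -- grind x₂
    have hg2i : 2 ≤ g2 := by omega
    constructor
    · unfold StateWins
      refine Game.Wins.move (m := ({2} : Finset (Fin 4))) ⟨Finset.singleton_nonempty 2, ?_⟩ ?_
      · exact two_le_ordAlong_add 2 _ _ _ _ (by simpa using hg2i) (by simpa using hg2i)
      rintro s' ⟨j', b, hj', hbj, -, -, rfl⟩
      rw [Finset.mem_singleton] at hj'
      subst hj'
      rw [hstate (step 2 _ _ b _)]
      rcases step_F_grind2_Q g2 g3 e2 e3 hg2 hg3 he2 he3 hg2i b hbj r exc with ⟨hF, -⟩ | ⟨hF, -⟩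
      · rw [hF]
        exact (IH (g2 + g3 + e2 + e3 - 2) (by omega) _ _ _ _ (by omega) (by split_ifs <;> assumption) he2
          (by split_ifs <;> assumption) (by split_ifs <;> omega) _ _).1
      · rw [hF]
        exact (IH (g2 + g3 + e2 + e3 - 2) (by omega) _ _ _ _ (by omega) (by split_ifs <;> assumption) he2
          (by split_ifs <;> assumption) (by split_ifs <;> omega) _ _).2
    · unfold StateWins
      refine Game.Wins.move (m := ({2} : Finset (Fin 4))) ⟨Finset.singleton_nonempty 2, ?_⟩ ?_
      · exact two_le_ordAlong_add_add 2 _ _ _ _ _ _ (by simpa using hg2i) (by simpa using hg2i) (by simpa using hg2i)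
      rintro s' ⟨j', b, hj', hbj, -, -, rfl⟩
      rw [Finset.mem_singleton] at hj'
      subst hj'
      rw [hstate (step 2 _ _ b _)]
      rcases step_F_grind2_R g2 g3 e2 e3 hg2 hg3 he2 he3 hg2i b hbj r exc with ⟨hF, -⟩ | ⟨hF, -⟩
      · rw [hF]
        exact (IH (g2 + g3 + e2 + e3 - 2) (by omega) _ _ _ _ (by omega) (by split_ifs <;> assumption) he2
          (by split_ifs <;> assumption) (by split_ifs <;> omega) _ _).2
      · rw [hF]
        exact (IH (g2 + g3 + e2 + e3 - 2) (by omega) _ _ _ _ (by omega) (by split_ifs <;> assumption) he2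
          (by split_ifs <;> assumption) (by split_ifs <;> omega) _ _).1

/-- **`Q·S²` wins**, every even dress, every booking. [OURS · counted 0] [folklore] -/
theorem stateWins_Q (g2 g3 e2 e3 : ℕ) (hg2 : g2 % 2 = 0) (hg3 : g3 % 2 = 0) (he2 : e2 % 2 = 0) (he3 : e3 % 2 = 0)
    (r : Fin 4 →₀ ℕ) (exc : Finset (Fin 4)) :
    StateWins 2 (⟨((∏ l, X l ^ (![1, 0, g2, g3] : Fin 4 → ℕ) l * (1 + X l) ^ (![0, 0, e2, e3] : Fin 4 → ℕ) l : MvPolynomial (Fin 4) (ZMod 2)) + (∏ l, X l ^ (![2, 1, g2, g3] : Fin 4 → ℕ) l * (1 + X l) ^ (![0, 0, e2, e3] : Fin 4 → ℕ) l : MvPolynomial (Fin 4) (ZMod 2))), r, exc⟩ : State (ZMod 2)) :=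
  (stateWins_QR _ g2 g3 e2 e3 hg2 hg3 he2 he3 le_rfl r exc).1

/-- **`R·S²` wins**, every even dress, every booking. [OURS · counted 0] [folklore] -/
theorem stateWins_R (g2 g3 e2 e3 : ℕ) (hg2 : g2 % 2 = 0) (hg3 : g3 % 2 = 0) (he2 : e2 % 2 = 0) (he3 : e3 % 2 = 0)
    (r : Fin 4 →₀ ℕ) (exc : Finset (Fin 4)) :
    StateWins 2 (⟨((∏ l, X l ^ (![1, 0, g2, g3] : Fin 4 → ℕ) l * (1 + X l) ^ (![0, 0, e2, e3] : Fin 4 → ℕ) l : MvPolynomial (Fin 4) (ZMod 2)) + (∏ l, X l ^ (![0, 1, g2, g3] : Fin 4 → ℕ) l * (1 + X l) ^ (![0, 0, e2, e3] : Fin 4 → ℕ) l : MvPolynomial (Fin 4) (ZMod 2)) + (∏ l, X l ^ (![2, 1, g2, g3] : Fin 4 → ℕ) l * (1 + X l) ^ (![0, 0, e2, e3] : Fin 4 → ℕ) l : MvPolynomial (Fin 4) (ZMod 2))), r, exc⟩ : State (ZMod 2)) :=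
  (stateWins_QR _ g2 g3 e2 e3 hg2 hg3 he2 he3 le_rfl r exc).2

end PureLeafNF

end Summit.ResolutionOfSingularities.ResolutionOfSingularities.Theorems.PIDim4

end
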